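import Literature.Analysis.FunctionSpaces.KMSStatesCounterexample
import HarnessLib

/-!
# The un-ordered identification `kmsGroundStates τ = {ω | ω.IsGroundState τ}` is false

Companion to `Literature/Analysis/FunctionSpaces/KMSStatesCounterexample.lean`. The named fact
`Literature.Analysis.FunctionSpaces.kmsGroundStates_eq` (`Literature/Analysis/FunctionSpaces/KMSStates.lean`,
after Bratteli–Robinson II Prop. 5.3.19: "the analytic (`β = +∞` KMS) ground states are exactly the
ground states in the generator form"), like its parent fact
`Literature.MathematicalPhysics.QuantumLattice.State.isGroundState_iff_isKMSGroundState`, was declared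
under `variable [PartialOrder A]` only, i.e. for an ARBITRARY partial order on the C⋆-algebra `A`,
for which `State A` (monotone linear `ω` with `ω 1 = 1`) need not consist of positive functionals.
This file records, sorry-free, that the fact is false in that generality
(`not_kmsGroundStates_eq`), by the counterexample of `KMSStatesCounterexample.lean`: on
`A = DiscreteB2` (Mathlib's `B(ℂ²)` with the discrete order) with the inner dynamics
`projDynamics proj _` of the projection `E₀₀`, the non-positive normalised functional `badState`
(`ω(x) = x₁₁ + x₀₁`) is an analytic ground state (`isKMSGroundState_badState`) but not a ground
state in the generator form (`not_isGroundState_badState`).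

The published statement concerns genuine (positive) states of the C⋆-algebra; its corrected form,
for the C⋆-order (`[StarOrderedRing A]`), is the sorry-free theorem
`Literature.MathematicalPhysics.QuantumLattice.State.kmsGroundStates_eq_setOf_isGroundState`
(`Literature/Analysis/FunctionSpaces/KMSStatesGroundStateProofs.lean`).

Deliberately NOT here: no new definitions; nothing about the corrected statements (see the files
quoted above).

Sources: O. Bratteli, D. W. Robinson, *Operator Algebras and Quantum Statistical Mechanics II*
(2nd ed., Springer 1997), Def. 5.3.18, Prop. 5.3.19; O. Bratteli, D. W. Robinson, *Operator
Algebras and Quantum Statistical Mechanics I* (2nd ed., Springer 1987), §2.3.2, p. 54 ("a positive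
linear functional `ω` over a C⋆-algebra with `‖ω‖ = 1` is called a state"); S. Sakai, *Operator
Algebras in Dynamical Systems* (CUP 1991), Def. 4.2.1 (ground state = state with
`-i φ(a⋆ δ(a)) ≥ 0`), Prop. 4.3.5. The counterexample itself is elementary linear algebra.
[folklore]
-/

noncomputable section

namespace Literature.Analysis.FunctionSpaces

namespace KMSGroundStateCounterexample

/-- **Refutation of the mis-stated fact `kmsGroundStates_eq`.**
`Literature.Analysis.FunctionSpaces.kmsGroundStates_eq`, read as stated — for every C⋆-algebra
`A`, EVERY partial order on `A` and every automorphism group `τ`,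
`kmsGroundStates τ = {ω | ω.IsGroundState τ}` — is false: on `A = DiscreteB2` with the inner
dynamics of `E₀₀`, `badState ∈ kmsGroundStates τ` (`isKMSGroundState_badState`) while `badState` is
not a ground state in the generator form (`not_isGroundState_badState`). The published result
(Bratteli–Robinson II Prop. 5.3.19) concerns genuine, positive states; the corrected, proved form
is `Literature.MathematicalPhysics.QuantumLattice.State.kmsGroundStates_eq_setOf_isGroundState`
(`[StarOrderedRing A]`). [folklore] -/
theorem not_kmsGroundStates_eq :
    ¬ ∀ (A : Type) [CStarAlgebra A] [PartialOrder A] (τ : ℝ → (A ≃⋆ₐ[ℂ] A)),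
        Literature.Analysis.FunctionSpaces.kmsGroundStates_eq (A := A) (τ := τ) := by
  intro h
  have hmem : badState ∈ kmsGroundStates (projDynamics proj isStarProjection_proj) :=
    isKMSGroundState_badState
  rw [h DiscreteB2 (projDynamics proj isStarProjection_proj)
    (isAutomorphismGroup_projDynamics proj isStarProjection_proj)] at hmem
  exact not_isGroundState_badState hmem

/-- Packaged form: on `DiscreteB2` there is a norm-continuous automorphism group `τ` for which the
analytic ground states `kmsGroundStates τ` and the generator-form ground states
`{ω | ω.IsGroundState τ}` are different sets (the former is not contained in the latter).
[folklore] -/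
theorem exists_kmsGroundStates_ne :
    ∃ τ : ℝ → (DiscreteB2 ≃⋆ₐ[ℂ] DiscreteB2),
      Literature.MathematicalPhysics.QuantumLattice.IsAutomorphismGroup τ ∧
        kmsGroundStates τ ≠
          {ω : Literature.MathematicalPhysics.QuantumLattice.State DiscreteB2 | ω.IsGroundState τ} := by
  refine ⟨projDynamics proj isStarProjection_proj,
    isAutomorphismGroup_projDynamics proj isStarProjection_proj, fun h => ?_⟩
  have hmem : badState ∈ kmsGroundStates (projDynamics proj isStarProjection_proj) :=
    isKMSGroundState_badState
  rw [h] at hmem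
  exact not_isGroundState_badState hmem

end KMSGroundStateCounterexample

end Literature.Analysis.FunctionSpaces
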